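import Literature.Topology.FourManifolds.HomotopySpheres
import Literature.Topology.FourManifolds.HomotopySpheresProofs
import Literature.Topology.FourManifolds.Morse
import Literature.Topology.FourManifolds.MorseExtrema
import Literature.Topology.FourManifolds.MorseReebSphereProofs
import Literature.Topology.FourManifolds.MorseSingleMinimumProofs
import Literature.Topology.FourManifolds.ConnectedSumData

/-!
# Stub `stub_morseFakeBall` of line `round-trace-continuity` for crux `OrigamiFoldExistence`
(item stmt-SmoothPoincare4-7844, route route-SmoothPoincare4-SymplecticOrigami)

The registered stub (lead reshape r4), VERBATIM.  M-sized: from a Morse function `f` on a homotopy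
`4`-sphere `S` without critical points of index `1`, a smooth embedding `e : ℝ⁴ → S` with
`e(B̊⁴) = {f < c}` a Morse ball about the minimum, and the Morse-form presentation `g := c - f` of the
fake ball `Δ_e = S ∖ e(B̊⁴) = {f ≥ c}`: the critical points of `g` in `{g ≤ 0}` lie in `{g < 0}`, are
nondegenerate, and have Morse index `4 - index_f ≤ 2`.

Proof (everything below is proved; no definitions, no named facts):

* `subsingleton_criticalSetOfIndex_zero` — **no `1`-handles ⇒ at most one minimum** on a closed
  connected `n`-manifold: the tree's THEOREM
  `Literature.Topology.FourManifolds.exists_isMorse_ncard_criticalSetOfIndex_zero_add_one_eq_holds`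
  (Matsumoto 2002, proof of Thm. 3.35 / Milnor 1965, Thm. 8.1: a second minimum is cancelled against a
  bridging `1`-handle, producing a Morse function with one FEWER critical point of index `1`) is absurd
  when there is no critical point of index `1`;
* the minimum `q` of `f` (compactness) is then the unique critical point of index `0`
  (`IsLocalMin.isMCriticalPt`, `IsMorse.morseIndex_eq_zero_of_isLocalMin`, `MorseExtrema.lean`), hence a
  STRICT minimum; the Lemma of Morse (`IsMorse.exists_chart_eq_quadratic_holds`) gives a chart `φ` at `q`
  with `f ∘ φ⁻¹ = f q + ‖·‖²`, and small sublevel sets are chart balls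
  (`exists_forall_sublevel_eq_image_closedBall`, Milnor 1963, proof of Thm. 4.1);
* `exists_isSmoothEmbedding_comp_univBall` — the chart disc `φ⁻¹ ∘ univBall 0 R : ℝⁿ → M` is a smooth
  embedding (`φ ≫ (univBall 0 R)⁻¹` lies in the maximal atlas and has target `univ`; tree
  `isSmoothEmbedding_symm_of_target_eq_univ`), and `‖univBall 0 R y‖² = R² ‖y‖² / (1 + ‖y‖²) < R²/2 ↔ ‖y‖ < 1`
  (`norm_sq_univBall_zero`, `norm_sq_univBall_lt_iff`), so `e(B̊⁴) = {f < f q + R²/2}` once `R` is below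
  the radius of the sublevel lemma and `R²/2` below the gap to the other (finitely many,
  `IsMorse.finite_criticalSet_holds`) critical values;
* `g := (f q + R²/2) - f`: same critical points (`isMCriticalPt_const_sub_iff`), Morse (`IsMorse.const_sub`),
  `index_g + index_f = 4` (`IsMorse.morseIndex_const_sub_add`, Milnor 1965, proof of Thm. 9.1), and off `q`
  the index of `f` is neither `0` (uniqueness) nor `1` (hypothesis).

References: Y. Matsumoto, *An Introduction to Morse Theory* (2002), Thm. 3.35 [Matsumoto2001];
J. Milnor, *Lectures on the h-cobordism theorem* (1965), Thm. 8.1, proof of Thm. 9.1 [MilnorHCobordism1965];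
J. Milnor, *Morse theory* (1963), Lemma 2.2, Thm. 4.1 [Milnor1963].
-/

noncomputable section

-- the prescribed namespace `Summit.<P>.<Sub>.…` duplicates `SmoothPoincare4` (P = Sub)
set_option linter.dupNamespace false

open scoped Manifold ContDiff Topology RealInnerProductSpace
open Set Function Metric OpenPartialHomeomorph
open Literature.Topology.FourManifolds

namespace Summit.SmoothPoincare4.SmoothPoincare4.Theorems.OrigamiFoldExistence.RoundTraceContinuity

/-! ### No `1`-handles: at most one critical point of index `0` -/

/-- **No critical point of index `1` ⇒ at most one critical point of index `0`** for a Morse function on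
a closed connected `n`-manifold: otherwise the cancellation step of Matsumoto's Thm. 3.35
(`exists_isMorse_ncard_criticalSetOfIndex_zero_add_one_eq_holds`: with `≥ 2` minima there is a Morse
function with exactly one fewer critical point of index `1`) would produce a negative count.
[cite: Matsumoto2001, proof of Thm. 3.35 (pp. 119–120)] -/
theorem subsingleton_criticalSetOfIndex_zero {n : ℕ} {M : Type*} [TopologicalSpace M] [T2Space M]
    [SecondCountableTopology M] [CompactSpace M] [ConnectedSpace M]
    [ChartedSpace (EuclideanSpace ℝ (Fin n)) M] [IsManifold (𝓡 n) ∞ M] {f : M → ℝ}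
    (hf : IsMorse (𝓡 n) f) (h1 : criticalSetOfIndex (𝓡 n) f 1 = ∅) :
    (criticalSetOfIndex (𝓡 n) f 0).Subsingleton := by
  have hfin : (criticalSetOfIndex (𝓡 n) f 0).Finite :=
    (IsMorse.finite_criticalSet_holds hf).subset (criticalSetOfIndex_subset (𝓡 n) f 0)
  have hle : (criticalSetOfIndex (𝓡 n) f 0).ncard ≤ 1 := by
    by_contra hlt
    obtain ⟨g, -, -, h1g, -⟩ :=
      exists_isMorse_ncard_criticalSetOfIndex_zero_add_one_eq_holds n M f hf (by omega)
    rw [h1, Set.ncard_empty] at h1g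
    omega
  intro a ha b hb
  exact (Set.ncard_le_one hfin).1 hle a ha b hb

/-! ### The chart disc `φ⁻¹ ∘ univBall 0 R` -/

/-- Mathlib's diffeomorphism `univBall 0 R : E ≅ B(0, R)` in closed form, through the norm:
`‖univBall 0 R y‖² = R² ‖y‖² / (1 + ‖y‖²)`. [folklore] -/
theorem norm_sq_univBall_zero {E : Type*} [NormedAddCommGroup E] [NormedSpace ℝ E] {R : ℝ}
    (hR : 0 < R) (y : E) :
    ‖univBall (0 : E) R y‖ ^ 2 = R ^ 2 * ‖y‖ ^ 2 / (1 + ‖y‖ ^ 2) := by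
  have h : univBall (0 : E) R y = R • ((Real.sqrt (1 + ‖y‖ ^ 2))⁻¹ • y) := by
    rw [univBall, dif_pos hR]
    simp [univUnitBall_apply]
  have hs : 0 < Real.sqrt (1 + ‖y‖ ^ 2) := Real.sqrt_pos.2 (by positivity)
  have hs2 : Real.sqrt (1 + ‖y‖ ^ 2) ^ 2 = 1 + ‖y‖ ^ 2 := Real.sq_sqrt (by positivity)
  rw [h, norm_smul, norm_smul, norm_inv, Real.norm_of_nonneg hR.le, Real.norm_of_nonneg hs.le,
    mul_pow, mul_pow, inv_pow, hs2]
  field_simp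

/-- `univBall 0 R` maps the open unit ball onto `B(0, R/√2)`: `‖univBall 0 R y‖² < R²/2 ↔ ‖y‖ < 1`.
[folklore] -/
theorem norm_sq_univBall_lt_iff {E : Type*} [NormedAddCommGroup E] [NormedSpace ℝ E] {R : ℝ}
    (hR : 0 < R) (y : E) :
    ‖univBall (0 : E) R y‖ ^ 2 < R ^ 2 / 2 ↔ ‖y‖ < 1 := by
  rw [norm_sq_univBall_zero hR, div_lt_iff₀ (by positivity : (0 : ℝ) < 1 + ‖y‖ ^ 2)]
  have hR2 : 0 < R ^ 2 := by positivity
  have hy : 0 ≤ ‖y‖ := norm_nonneg y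
  have hsq : ‖y‖ ^ 2 < 1 ↔ ‖y‖ < 1 := by
    constructor <;> intro h <;> nlinarith [hy]
  rw [← hsq]
  constructor <;> intro h <;> nlinarith [hR2]

/-- **The chart disc of a chart of the maximal atlas.** If `φ` is a chart of the maximal `C^∞` atlas
of an `n`-manifold with `B(0, R) ⊆ φ.target`, then `φ⁻¹ ∘ univBall 0 R : ℝⁿ → M` is a smooth embedding
of the whole model space (`φ ≫ (univBall 0 R)⁻¹` is a chart of the maximal atlas with target `univ`,
whose inverse is a smooth embedding — tree `isSmoothEmbedding_symm_of_target_eq_univ`; cf.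
`exists_chart_ball`, Kosinski, *Differential Manifolds* (1993), VI.1). [folklore] -/
theorem exists_isSmoothEmbedding_comp_univBall {n : ℕ} {M : Type*} [TopologicalSpace M]
    [ChartedSpace (EuclideanSpace ℝ (Fin n)) M] [IsManifold (𝓡 n) ∞ M]
    {φ : OpenPartialHomeomorph M (EuclideanSpace ℝ (Fin n))}
    (hφ : φ ∈ IsManifold.maximalAtlas (𝓡 n) ∞ M) {R : ℝ} (hR : 0 < R)
    (hsub : ball (0 : EuclideanSpace ℝ (Fin n)) R ⊆ φ.target) :
    ∃ e : EuclideanSpace ℝ (Fin n) → M, Manifold.IsSmoothEmbedding (𝓡 n) (𝓡 n) ∞ e ∧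
      ∀ y, e y = φ.symm (univBall (0 : EuclideanSpace ℝ (Fin n)) R y) := by
  set u := univBall (0 : EuclideanSpace ℝ (Fin n)) R with hu
  have hut : u.target = ball 0 R := univBall_target 0 hR
  have hus : u.source = univ := univBall_source 0 R
  have huball : ∀ y, u y ∈ φ.target := fun y =>
    hsub (hut ▸ u.map_source (by rw [hus]; exact mem_univ y))
  have hmem : φ ≫ₕ u.symm ∈ IsManifold.maximalAtlas (𝓡 n) ∞ M := by
    apply OpenPartialHomeomorph.mem_maximalAtlas_of_contMDiffOn
    · rw [trans_source, coe_trans, symm_source, hut]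
      exact contDiffOn_univBall_symm.contMDiffOn.comp
        ((contMDiffOn_of_mem_maximalAtlas hφ).mono inter_subset_left) fun y hy => hy.2
    · rw [trans_symm_eq_symm_trans_symm, symm_symm]
      exact (contMDiffOn_symm_of_mem_maximalAtlas hφ).comp contDiff_univBall.contMDiff.contMDiffOn
        fun y _ => huball y
  have htgt : (φ ≫ₕ u.symm).target = univ := by
    rw [trans_target, symm_target, hus, univ_inter, eq_univ_iff_forall]
    intro y
    rw [mem_preimage, symm_symm]
    exact huball y
  exact ⟨(φ ≫ₕ u.symm).symm, isSmoothEmbedding_symm_of_target_eq_univ hmem htgt, fun y => rfl⟩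

/-! ### The stub -/

/-- **Stub `stub_morseFakeBall` (Morse fake ball in Morse form).** If the homotopy 4-sphere `S` carries a Morse function
`f` without index-1 critical points, then there are a smooth embedding `e : ℝ⁴ → S` and a smooth `g : S → ℝ` with
`{g ≤ 0} = S ∖ e(B̊⁴)` whose critical points in `{g ≤ 0}` lie in `{g < 0}`, are nondegenerate, and have Morse index `≤ 2`.
Proof: `f` has a unique minimum `q` (no 1-handles and `S` connected); `e` = radially reparametrised Morse chart at `q` with
`e(B̊⁴) = {f < c}`, `c` just above `f q` and below every other critical value; `g := c - f` (so `{g ≤ 0} = {f ≥ c}`), whose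
critical points off `q` are those of `f`, with `morseIndex g = morseIndex (-f) = 4 - morseIndex f ∈ {0, 1, 2}`. [folklore] -/
theorem stub_morseFakeBall :
    ∀ S : Literature.Topology.FourManifolds.HomotopySphere 4, (∃ f : S.carrier → ℝ, Literature.Topology.FourManifolds.IsMorse (𝓡 4) f ∧ Literature.Topology.FourManifolds.criticalSetOfIndex (𝓡 4) f 1 = ∅) → ∃ (e : EuclideanSpace ℝ (Fin 4) → S.carrier) (g : S.carrier → ℝ), Manifold.IsSmoothEmbedding (𝓡 4) (𝓡 4) ∞ e ∧ ContMDiff (𝓡 4) 𝓘(ℝ, ℝ) ∞ g ∧ {x | g x ≤ 0} = {x | x ∉ e '' Metric.ball (0 : EuclideanSpace ℝ (Fin 4)) 1} ∧ ∀ x, g x ≤ 0 → Literature.Topology.FourManifolds.IsMCriticalPt (𝓡 4) g x → g x < 0 ∧ (Literature.Topology.FourManifolds.mhessian (𝓡 4) g x).Nondegenerate ∧ Literature.Topology.FourManifolds.morseIndex (𝓡 4) g x + 1 ≤ 3 := by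
  intro S hS
  obtain ⟨f, hf, h1⟩ := hS
  haveI : ConnectedSpace S.carrier := HomotopySphere.connectedSpace (by norm_num) S
  haveI : Nonempty S.carrier := HomotopySphere.nonempty S
  have hcont : Continuous f := hf.contMDiff.continuous
  have hdiff : ∀ z, MDifferentiableAt (𝓡 4) 𝓘(ℝ, ℝ) f z := fun z =>
    hf.contMDiff.mdifferentiableAt (by simp)
  -- (a) no `1`-handles: the critical points of index `0` form a subsingleton
  have hsub0 : (criticalSetOfIndex (𝓡 4) f 0).Subsingleton := subsingleton_criticalSetOfIndex_zero hf h1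
  -- the minimum `q` of `f` is a critical point of index `0`, hence the unique one, hence strict
  obtain ⟨q, -, hqmin⟩ := isCompact_univ.exists_isMinOn univ_nonempty hcont.continuousOn
  have hqle : ∀ x, f q ≤ f x := fun x => isMinOn_iff.1 hqmin x (mem_univ x)
  have hqloc : IsLocalMin f q := hqmin.isLocalMin Filter.univ_mem
  have hqc : IsMCriticalPt (𝓡 4) f q := IsLocalMin.isMCriticalPt hqloc
  have hq0 : morseIndex (𝓡 4) f q = 0 := hf.morseIndex_eq_zero_of_isLocalMin hqloc
  have hstrict : ∀ x, x ≠ q → f q < f x := by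
    intro x hx
    refine lt_of_le_of_ne (hqle x) fun heq => hx ?_
    have hxloc : IsLocalMin f x :=
      Filter.Eventually.of_forall fun y => by rw [← heq]; exact hqle y
    exact hsub0 ⟨IsLocalMin.isMCriticalPt hxloc, hf.morseIndex_eq_zero_of_isLocalMin hxloc⟩ ⟨hqc, hq0⟩
  -- (b) the Morse chart at `q`: `f ∘ φ⁻¹ = f q + ‖·‖²`, and small sublevel sets are chart balls
  obtain ⟨φ, hφA, hqφ, hφq, hquad⟩ := IsMorse.exists_chart_eq_quadratic_holds hf hqc
  have hquad' : ∀ y ∈ φ.target, f (φ.symm y) = f q + ‖y‖ ^ 2 := by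
    intro y hy
    rw [hquad y hy, hq0]
    have e1 : (Finset.univ.filter fun i : Fin 4 => i.val < 0) = ∅ := by ext i; simp
    have e2 : (Finset.univ.filter fun i : Fin 4 => 0 ≤ i.val) = Finset.univ := by ext i; simp
    rw [e1, e2, Finset.sum_empty, sub_zero, EuclideanSpace.real_norm_sq_eq]
  obtain ⟨ε₀, hε₀, H⟩ := exists_forall_sublevel_eq_image_closedBall hcont hstrict φ hqφ hφq hquad'
  -- (c) a gap `δ > 0` below the other (finitely many) critical values
  have hfin : (criticalSet (𝓡 4) f).Finite := IsMorse.finite_criticalSet_holds hf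
  obtain ⟨δ, hδ, hgap⟩ :
      ∃ δ : ℝ, 0 < δ ∧ ∀ p, IsMCriticalPt (𝓡 4) f p → p ≠ q → f q + δ ≤ f p := by
    classical
    rcases (hfin.toFinset.erase q).eq_empty_or_nonempty with hTe | hTne
    · refine ⟨1, one_pos, fun p hp hpq => ?_⟩
      have hpT : p ∈ hfin.toFinset.erase q := Finset.mem_erase.2 ⟨hpq, hfin.mem_toFinset.2 hp⟩
      rw [hTe] at hpT
      exact absurd hpT (Finset.notMem_empty p)
    · obtain ⟨p₀, hp₀, hmin⟩ := (hfin.toFinset.erase q).exists_min_image f hTne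
      refine ⟨f p₀ - f q, sub_pos.2 (hstrict p₀ (Finset.mem_erase.1 hp₀).1), fun p hp hpq => ?_⟩
      have := hmin p (Finset.mem_erase.2 ⟨hpq, hfin.mem_toFinset.2 hp⟩)
      linarith
  -- (d) the radius `R`: below `ε₀`, `1` and `δ`, so that `R²/2 < δ`
  obtain ⟨R, hRpos, hRε₀, hR1, hRδ⟩ : ∃ R : ℝ, 0 < R ∧ R ≤ ε₀ ∧ R ≤ 1 ∧ R ≤ δ :=
    ⟨min ε₀ (min 1 δ), lt_min hε₀ (lt_min one_pos hδ), min_le_left _ _,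
      (min_le_right _ _).trans (min_le_left _ _), (min_le_right _ _).trans (min_le_right _ _)⟩
  have hR2δ : R ^ 2 / 2 < δ := by nlinarith
  obtain ⟨hballR, hsubR⟩ := H R hRpos hRε₀
  have hballR' : ball (0 : EuclideanSpace ℝ (Fin 4)) R ⊆ φ.target := ball_subset_closedBall.trans hballR
  -- the chart disc `e = φ⁻¹ ∘ univBall 0 R`
  obtain ⟨e, he, heφ⟩ := exists_isSmoothEmbedding_comp_univBall hφA hRpos hballR'
  have huball : ∀ y, univBall (0 : EuclideanSpace ℝ (Fin 4)) R y ∈ ball (0 : EuclideanSpace ℝ (Fin 4)) R :=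
    fun y => by
      rw [← univBall_target (0 : EuclideanSpace ℝ (Fin 4)) hRpos]
      exact (univBall (0 : EuclideanSpace ℝ (Fin 4)) R).map_source (by simp)
  -- the key identification `{f < c} = e(B̊⁴)`, `c = f q + R²/2`
  have hkey : ∀ x, f x < f q + R ^ 2 / 2 ↔ x ∈ e '' ball (0 : EuclideanSpace ℝ (Fin 4)) 1 := by
    intro x
    constructor
    · intro hx
      have hx' : x ∈ {x | f x ≤ f q + R ^ 2} := by
        simp only [mem_setOf_eq]
        nlinarith
      rw [hsubR] at hx'
      obtain ⟨z, hz, rfl⟩ := hx'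
      have hz2 : ‖z‖ ^ 2 < R ^ 2 / 2 := by
        rw [hquad' z (hballR hz)] at hx
        linarith
      have hzR : ‖z‖ < R := lt_of_pow_lt_pow_left₀ 2 hRpos.le (by linarith [sq_nonneg R])
      have hzt : z ∈ (univBall (0 : EuclideanSpace ℝ (Fin 4)) R).target := by
        rw [univBall_target (0 : EuclideanSpace ℝ (Fin 4)) hRpos]
        exact mem_ball_zero_iff.2 hzR
      refine ⟨(univBall (0 : EuclideanSpace ℝ (Fin 4)) R).symm z, ?_, ?_⟩
      · have h := norm_sq_univBall_lt_iff hRpos ((univBall (0 : EuclideanSpace ℝ (Fin 4)) R).symm z)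
        rw [(univBall (0 : EuclideanSpace ℝ (Fin 4)) R).right_inv hzt] at h
        exact mem_ball_zero_iff.2 (h.1 hz2)
      · rw [heφ, (univBall (0 : EuclideanSpace ℝ (Fin 4)) R).right_inv hzt]
    · rintro ⟨y, hy, rfl⟩
      rw [heφ, hquad' _ (hballR' (huball y))]
      have h := (norm_sq_univBall_lt_iff hRpos y).2 (mem_ball_zero_iff.1 hy)
      linarith
  -- (e) the Morse-form presentation `g = c - f`
  refine ⟨e, fun x => (f q + R ^ 2 / 2) - f x, he, (hf.const_sub _).contMDiff, ?_, ?_⟩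
  · ext x
    simp only [mem_setOf_eq]
    exact sub_nonpos.trans (not_lt.symm.trans (not_congr (hkey x)))
  · intro x hx hxg
    have hx' : f q + R ^ 2 / 2 ≤ f x := by simpa only [sub_nonpos] using hx
    have hxf : IsMCriticalPt (𝓡 4) f x := (isMCriticalPt_const_sub_iff _ (hdiff x)).1 hxg
    have hxq : x ≠ q := by
      rintro rfl
      nlinarith
    have hgapx := hgap x hxf hxq
    refine ⟨by dsimp only; linarith, (hf.const_sub _).nondegenerate hxg, ?_⟩
    have hadd := hf.morseIndex_const_sub_add (f q + R ^ 2 / 2) hxf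
    rw [finrank_euclideanSpace_fin] at hadd
    have hne0 : morseIndex (𝓡 4) f x ≠ 0 := fun h0 => hxq (hsub0 ⟨hxf, h0⟩ ⟨hqc, hq0⟩)
    have hne1 : morseIndex (𝓡 4) f x ≠ 1 := fun h1' => by
      have hx1 : x ∈ criticalSetOfIndex (𝓡 4) f 1 := ⟨hxf, h1'⟩
      rw [h1] at hx1
      exact absurd hx1 (Set.notMem_empty x)
    omega

end Summit.SmoothPoincare4.SmoothPoincare4.Theorems.OrigamiFoldExistence.RoundTraceContinuity

end
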